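import Mathlib
import Literature.MathematicalPhysics.QuantumFieldTheory.Balaban1983to89.B6Eq250
import Literature.MathematicalPhysics.QuantumFieldTheory.Balaban1983to89.B6RandomWalk
import Literature.MathematicalPhysics.QuantumFieldTheory.Balaban1983to89.B6CoverBox

/-!
# `Balaban1983to89.B6Ineq249Proof` — T. Bałaban, *Propagators and renormalization transformations for lattice gauge
theories. II*, Commun. Math. Phys. **96** (1984) 223–250 [Balaban1984PropagatorsII]: the bound **(2.49)
`|Rλ| ≤ O(M⁻¹)|λ|`** PROVED from (2.38) + (2.44) as printed, the operator-norm form *"R has a small norm in the space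
L^∞ for M sufficiently large"* discharging the hypothesis `hR : ‖R‖ < 1` of `B6Eq250.neumann250` (⇒ (2.50)), and the
instance on the printed cube cover (one level, the box model of `B6CoverBox`)

statement-level skeleton of published theorems with citation tags; proofs where landed; nothing here is a claim about the Yang–Mills mass gap.
PDF held: `paper:balaban1984-cmp96-propagators-rt-ii` (journal page = PDF page + 222); pp. 229–232 [PDF 7–10] read this
session from the ×2 renders `run/shared/lean/pub/pub-balaban/b2b-balaban-ref1/pages/1984-cmp96-propagators-rt-II/…-p007…
p010-x2.png`.

CITATION HEADER (cell `lit-balaban`, Phase-2 proof seat `p01` = unit `lit-balaban-p01`, HOME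
`run/shared/lean/pub/lit-balaban/` (`PHASE2-TARGETS.md` §G.3 line p01, `PHASE2-PACKETS.md` §p01); SKELETON row
**`B6.Eq2.49`** ((2.49)–(2.50) p. 232)).  Companions IMPORTED, not modified: `…B6Eq250` (p241200, reader r03: the objects
`kOp` = K(h), `gZero` = G′₀ (2.37), `rOp` = R, `bTerm` = K(h_□)G′(□)h_□ (2.38) in a ring of operators, and **(2.49) ⇒
(2.50)** `neumann250` under the hypothesis `hR : ‖R‖ < 1`); `…B6RandomWalk` (unit pv08: the printed block-bound shape
`HasMajorant` / `BlockSupp` / `blockPiece` of (2.51) ff.); `…B6CoverBox` (the printed cover 𝒟 and partition {h_□} of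
(2.36) IN COORDINATES on one level: `hprof`, `sum_hprof_sq` = (2.36), `card_filter_hprof_ne_zero_le` = the 2^d-fold
overlap, `boxGeo`, `boxGeo_profile` = the (2.61)-type lattice sum with the volume-independent constant `Kbox`).
WHAT THE PAPER PRINTS (p. 232 [PDF 10], verbatim): *"Now let us come back to the inequality (2.44) and its consequences.
One of them follows from the equality (2.38) where the operator R was defined. We get |Rλ| ≤ O(M⁻¹)|λ|, (2.49) thus the
operator R has a small norm in the space L^∞ for M sufficiently large, and we get G′ = G′₀(I − R)⁻¹ = G′₀Σ_{n=0}^∞ Rⁿ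
= … (2.50)"*; the inputs, verbatim: (2.38) p. 229 *"Δ′_aG′₀ = I − Σ_□ K(h_□)G′(□)h_□ = I − R"*; (2.44) p. 230
*"|(K(h_□)G′(□)h_□λ)(x)| ≤ O(M⁻¹)e^{−δ₀|x−y|}|λ| (2.44) if either supp λ ⊂ B^j(y) for y ∈ Λ_j, or supp λ ⊂ B^{j+1}(y)
for y ∈ Λ_{j+1}. The distance in the above inequality is measured on L^{−j}-scale."*; the cover, p. 229: *"We cover
B^j(Λ_j) by a sum of cubes □ of the size 2ML^jη, each cube being a sum of 2^d big blocks with a center y ∈ Λ_j … They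
satisfy Σ_{□∈𝒟} h_□² = 1. (2.36)"*.
WHAT IS PROVED HERE (0 sorry, 0 new definitions, 0 named facts; every analytic input is a hypothesis OF THE PRINTED
SHAPE).  The printed sentence is a three-line argument which the file spells out: write λ = Σ_y λ↾B(y) (the blocks
partition the lattice), apply (2.44) to each term K(h_□)G′(□)h_□(λ↾B(y)) — it VANISHES unless the cube □ meets the block
B(y) (h_□ is carried by □; at most n₀ cubes of 𝒟 meet a given block, n₀ = 2^d per level by the quoted geometry) — and sum
the exponentials over the blocks y, Σ_y e^{−δ₀|x−y|} ≤ C₁ (a unit-lattice sum, the (2.61)-type profile):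
|(Rλ)(x)| ≤ n₀·C₁·O(M⁻¹)·|λ|.
§1 `supBound_of_hasMajorant` — a block majorant K(y,y′) with row sums Σ_{y′}K(y,y′) ≤ C gives the sup-norm bound
  |(Tλ)(x)| ≤ C|λ| (the summation over blocks);
§2 `hasMajorant_sum_of_244`, `supBound_of_244` — (2.38) + (2.44): for a finite family T_□ with (2.44)-majorants
  θ·w(y,y′) on the blocks met by □, killing the blocks not met, ≤ n₀ cubes per block, Σ_{y′}w(y,y′) ≤ C₁:
  R = Σ_□T_□ has majorant n₀θ·w and |(Rλ)(x)| ≤ n₀C₁θ|λ| — over an ABSTRACT lattice X with block map `blk : X → 𝔅`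
  into any `B6.Geometry` (the vocabulary of `B6RandomWalk`, so that the typed rows (2.44)/(2.51) feed it by name);
§3 the printed *"small norm in the space L^∞"*: in the Banach algebra 𝔄 = ((X → ℝ) →L[ℝ] (X → ℝ)) of bounded operators
  on L^∞(X) (sup norm), with `R = B6Eq250.rOp D h g` and the (2.44)-majorants assumed for the summands
  `B6Eq250.bTerm D h g □ = K(h_□)G′(□)h_□`: **`ineq249`** (|(Rλ)(x)| ≤ n₀C₁θ‖λ‖_∞ — (2.49) with O(M⁻¹) = n₀C₁θ explicit),
  `opNorm_rOp_le` (‖R‖_{L^∞→L^∞} ≤ n₀C₁θ), `norm_rOp_lt_one_of_large` (θ ≤ cM⁻¹ and M > n₀C₁c ⇒ ‖R‖ < 1: *"M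
  sufficiently large"* LOCATED), **`neumann250_of_244`** ((2.44) + (2.36) + local inverses + G′Δ′_a = I ⇒ (2.50)
  `HasSum (G′₀Rⁿ) G′`, by `B6Eq250.neumann250`);
§4 the instance on the PRINTED COVER, one level, with the field lattice taken equal to the unit lattice of block
  centres (blocks = sites, i.e. the level j = 0 of the cover, B⁰(y) = {y}; for j ≥ 1 the fine blocks enter §3 through
  `blk`) — the box model of `B6CoverBox`: sites {0,…,nM}^d, cubes □_k of side 2M centred on the M-lattice, h_k =
  Π_μ h((x_μ − k_μM)/M): `box_sum_h_mul_h` ((2.36) as the operator identity Σ_kh_kh_k = I), **`box_ineq249`** (kernel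
  form of (2.44), |T_□(x,y)| ≤ θe^{−δ₀|x−y|₁} for every cube ⇒ |(Rλ)(x)| ≤ 2^d·K_d(δ₀)·θ·‖λ‖_∞ with K_d(δ₀) =
  (2(1 − e^{−δ₀})⁻¹)^d: the overlap number n₀ = 2^d and the lattice sum DISCHARGED, uniformly in the volume),
  **`box_neumann250_of_244`** (θ ≤ c/M and M > 2^dK_d(δ₀)c ⇒ (2.50) converges to G′ in the L^∞ operator norm);
§5 (v1.1) `hasMajorant251_of_244`, `hasMajorant251_rOp_of_244` — **(2.44) ⇒ (2.51)** p. 232 *"From (2.44) and (2.38) we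
  have |(Rλ)(x)| ≤ O(M⁻¹)e^{−δ₀d(x,y)}|λ| if supp λ ⊂ B^j(y)"*: with the (2.44) factor read as e^{−δ₀d(y(x),y)} in the
  multiscale distance d of (2.46), `R` has the (2.51) majorant (n₀θ)·e^{−δ₀d(y,y′)} — the hypothesis `hR` of
  `B6RandomWalk.majorant_pow_265` / `majorant_of_fixedPoint_266`, so (2.44) → (2.51) → (2.64)–(2.66) is now one chain.
NOT proved here (inputs, exactly as in print): (2.44) itself (row `B6.Eq2.44`: it rests on (2.40)–(2.43) = Lemmas 2.2,
2.4, Prop. 2.3 of [3]); the existence of Δ′_a⁻¹ (positivity (2.11)); the Hölder-norm clause of (2.50) (same algebra in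
the Hölder operator algebra, not instantiated); multi-level covers in the model (the abstract §§1–3 cover them).  TYPED READING of (2.44)'s *"|x − y| on L^{−j}-scale"*: an arbitrary non-negative block kernel w(y,y′) with
summable rows (§§2–3), the ℓ¹ lattice distance of the box model in §4 (dictionary D-pv08g2.1 of `B6BoxCharts`).
-/

namespace Literature.MathematicalPhysics.QuantumFieldTheory.Balaban1983to89.B6Ineq249Proof

open Finset
open B6RandomWalk (HasMajorant BlockSupp blockPiece sum_blockPiece blockSupp_blockPiece)
open B6Eq250 (kOp gZero rOp bTerm)

/-! ## §1. A block majorant with summable rows gives a sup-norm bound -/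

section SupBound

variable {g : B6.Geometry} {X : Type}

/-- The summation step behind (2.49): if `T` has the block majorant `K` (*"|(Tλ)(x)| ≤ K(y,y′)|λ|, x ∈ B(y),
supp λ ⊂ B(y′)"*) and the rows of `K` are summable, `Σ_{y′} K(y,y′) ≤ C`, then for EVERY `λ` (decomposed over the blocks,
`λ = Σ_{y′} λ↾B(y′)`) `|(Tλ)(x)| ≤ C·|λ|`. [cite: Balaban1984PropagatorsII, (2.49) p.232] -/
theorem supBound_of_hasMajorant (blk : X → g.Site) {T : Module.End ℝ (X → ℝ)} {K : g.Site → g.Site → ℝ}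
    (hT : HasMajorant blk T K) {C : ℝ} (hrow : ∀ a, ∑ b, K a b ≤ C) (μ : X → ℝ) {B : ℝ} (hB : 0 ≤ B)
    (hμ : ∀ x, |μ x| ≤ B) (x : X) : |T μ x| ≤ C * B := by
  have hpiece : ∀ b : g.Site, |T (blockPiece blk b μ) x| ≤ K (blk x) b * B := fun b =>
    hT b _ _ (blockSupp_blockPiece blk μ b B hB fun x' _ => hμ x') x
  have hdec : T μ x = ∑ b : g.Site, T (blockPiece blk b μ) x := by
    conv_lhs => rw [← sum_blockPiece blk μ]
    rw [map_sum, Finset.sum_apply]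
  rw [hdec]
  calc |∑ b : g.Site, T (blockPiece blk b μ) x|
      ≤ ∑ b, |T (blockPiece blk b μ) x| := Finset.abs_sum_le_sum_abs _ _
    _ ≤ ∑ b, K (blk x) b * B := Finset.sum_le_sum fun b _ => hpiece b
    _ = (∑ b, K (blk x) b) * B := by rw [Finset.sum_mul]
    _ ≤ C * B := mul_le_mul_of_nonneg_right (hrow _) hB

/-! ## §2. (2.38) + (2.44) ⇒ (2.49) over an abstract lattice -/

variable {ι : Type*} [Fintype ι]

/-- **(2.38) + (2.44) ⇒ a majorant of `R = Σ_{□∈𝒟} T_□`**, `T_□ = K(h_□)G′(□)h_□`: if every `T_□` obeys the (2.44)-shape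
bound `|(T_□λ)(x)| ≤ θ·w(y,y′)|λ|` for `supp λ ⊂ B(y′)` and the cubes `□ ∈ cubesOf y′` meeting that block, annihilates the
`λ` supported in blocks it does not meet (h_□ is carried by □), and at most `n₀` cubes meet a block (p. 229: the cubes of
side 2ML^jη on the ML^jη-lattice, *"each cube being a sum of 2^d big blocks"*), then `R` has the majorant `n₀θ·w(y,y′)`.
[cite: Balaban1984PropagatorsII, (2.38) p.229, (2.44) p.230, (2.49) p.232] -/
theorem hasMajorant_sum_of_244 (blk : X → g.Site) (T : ι → Module.End ℝ (X → ℝ)) (cubesOf : g.Site → Finset ι)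
    (w : g.Site → g.Site → ℝ) {θ : ℝ} {n₀ : ℕ} (hθ : 0 ≤ θ) (hw : ∀ a b, 0 ≤ w a b)
    (h244 : ∀ b, ∀ i ∈ cubesOf b, ∀ (μ : X → ℝ) (B : ℝ), BlockSupp blk μ b B →
      ∀ x, |T i μ x| ≤ θ * w (blk x) b * B)
    (hkill : ∀ b, ∀ i ∉ cubesOf b, ∀ (μ : X → ℝ) (B : ℝ), BlockSupp blk μ b B → T i μ = 0)
    (hcount : ∀ b, (cubesOf b).card ≤ n₀) :
    HasMajorant blk (∑ i, T i) (fun a b => n₀ * θ * w a b) := by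
  intro b ν B hν x
  rw [LinearMap.sum_apply, Finset.sum_apply]
  have hsplit : ∑ i, T i ν x = ∑ i ∈ cubesOf b, T i ν x :=
    (Finset.sum_subset (Finset.subset_univ _) fun i _ hi => by rw [hkill b i hi ν B hν]; rfl).symm
  rw [hsplit]
  calc |∑ i ∈ cubesOf b, T i ν x|
      ≤ ∑ i ∈ cubesOf b, |T i ν x| := Finset.abs_sum_le_sum_abs _ _
    _ ≤ ∑ i ∈ cubesOf b, θ * w (blk x) b * B := Finset.sum_le_sum fun i hi => h244 b i hi ν B hν x
    _ = (cubesOf b).card * (θ * w (blk x) b * B) := by rw [Finset.sum_const, nsmul_eq_mul]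
    _ ≤ n₀ * (θ * w (blk x) b * B) :=
        mul_le_mul_of_nonneg_right (by exact_mod_cast hcount b)
          (mul_nonneg (mul_nonneg hθ (hw _ _)) hν.nonneg)
    _ = n₀ * θ * w (blk x) b * B := by ring

/-- **(2.38) + (2.44) ⇒ (2.49)** over an abstract lattice: with the hypotheses of `hasMajorant_sum_of_244` and the
lattice sum `Σ_{y′} w(y,y′) ≤ C₁` (the printed Σ_y e^{−δ₀|x−y|} over the unit lattice of centres), every `λ` with
`|λ| ≤ B` satisfies `|(Rλ)(x)| ≤ n₀·C₁·θ·B` — *"|Rλ| ≤ O(M⁻¹)|λ|"* with O(M⁻¹) = n₀C₁·θ, θ = the O(M⁻¹) of (2.44).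
[cite: Balaban1984PropagatorsII, (2.49) p.232] -/
theorem supBound_of_244 (blk : X → g.Site) (T : ι → Module.End ℝ (X → ℝ)) (cubesOf : g.Site → Finset ι)
    (w : g.Site → g.Site → ℝ) {θ C₁ : ℝ} {n₀ : ℕ} (hθ : 0 ≤ θ) (hw : ∀ a b, 0 ≤ w a b)
    (h244 : ∀ b, ∀ i ∈ cubesOf b, ∀ (μ : X → ℝ) (B : ℝ), BlockSupp blk μ b B →
      ∀ x, |T i μ x| ≤ θ * w (blk x) b * B)
    (hkill : ∀ b, ∀ i ∉ cubesOf b, ∀ (μ : X → ℝ) (B : ℝ), BlockSupp blk μ b B → T i μ = 0)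
    (hcount : ∀ b, (cubesOf b).card ≤ n₀) (hsum : ∀ a, ∑ b, w a b ≤ C₁)
    (μ : X → ℝ) {B : ℝ} (hB : 0 ≤ B) (hμ : ∀ x, |μ x| ≤ B) (x : X) :
    |(∑ i, T i) μ x| ≤ n₀ * C₁ * θ * B := by
  have hmaj := hasMajorant_sum_of_244 blk T cubesOf w hθ hw h244 hkill hcount
  have hrow : ∀ a, ∑ b, (n₀ : ℝ) * θ * w a b ≤ n₀ * C₁ * θ := fun a => by
    rw [← Finset.mul_sum]
    calc (n₀ : ℝ) * θ * ∑ b, w a b ≤ n₀ * θ * C₁ :=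
          mul_le_mul_of_nonneg_left (hsum a) (mul_nonneg (Nat.cast_nonneg _) hθ)
      _ = n₀ * C₁ * θ := by ring
  exact supBound_of_hasMajorant blk hmaj hrow μ hB hμ x

end SupBound

/-! ## §3. *"thus the operator R has a small norm in the space L^∞ for M sufficiently large"* — the operator algebra
of L^∞(X) and the hypothesis `hR` of `B6Eq250.neumann250` -/

section LInfty

variable {g : B6.Geometry} {X : Type} [Fintype X] {ι : Type*} [Fintype ι]

/-- **(2.49) `|Rλ| ≤ O(M⁻¹)|λ|`** for `R = Σ_□ K(h_□)G′(□)h_□` (= `B6Eq250.rOp D h g`, `bTerm D h g □` its summand) acting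
on L^∞(X) = (X → ℝ, sup norm): from the (2.44)-majorants `θ·w` of the summands on the blocks met by their cube, the
locality of the cut-offs `h_□` (they kill functions supported in blocks their cube does not meet; ≤ n₀ cubes per
block) and the lattice sum `Σ_{y′}w(y,y′) ≤ C₁`: `|(Rλ)(x)| ≤ n₀C₁θ·‖λ‖_∞`. [cite: Balaban1984PropagatorsII, (2.49) p.232] -/
theorem ineq249 (blk : X → g.Site) (D : (X → ℝ) →L[ℝ] (X → ℝ)) (h gl : ι → (X → ℝ) →L[ℝ] (X → ℝ))
    (cubesOf : g.Site → Finset ι) (w : g.Site → g.Site → ℝ) {θ C₁ : ℝ} {n₀ : ℕ} (hθ : 0 ≤ θ)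
    (hw : ∀ a b, 0 ≤ w a b)
    (h244 : ∀ b, ∀ i ∈ cubesOf b, ∀ (μ : X → ℝ) (B : ℝ), BlockSupp blk μ b B →
      ∀ x, |bTerm D h gl i μ x| ≤ θ * w (blk x) b * B)
    (hkill : ∀ b, ∀ i ∉ cubesOf b, ∀ (μ : X → ℝ) (B : ℝ), BlockSupp blk μ b B → h i μ = 0)
    (hcount : ∀ b, (cubesOf b).card ≤ n₀) (hsum : ∀ a, ∑ b, w a b ≤ C₁) (μ : X → ℝ) (x : X) :
    |rOp D h gl μ x| ≤ n₀ * C₁ * θ * ‖μ‖ := by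
  have hR : rOp D h gl μ x = (∑ i, (↑(bTerm D h gl i) : Module.End ℝ (X → ℝ))) μ x := by
    simp only [B6Eq250.rOp_eq_sum_bTerm, _root_.sum_apply, LinearMap.sum_apply, Finset.sum_apply,
      ContinuousLinearMap.coe_coe]
  have hkill' : ∀ b, ∀ i ∉ cubesOf b, ∀ (μ : X → ℝ) (B : ℝ), BlockSupp blk μ b B →
      (↑(bTerm D h gl i) : Module.End ℝ (X → ℝ)) μ = 0 := by
    intro b i hi ν B hν
    rw [ContinuousLinearMap.coe_coe, B6Eq250.bTerm_apply, mul_apply_eq_comp, mul_apply_eq_comp,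
      hkill b i hi ν B hν, map_zero, map_zero]
  rw [hR]
  exact supBound_of_244 blk (fun i => (↑(bTerm D h gl i) : Module.End ℝ (X → ℝ))) cubesOf w hθ hw
    (fun b i hi ν B hν y => by rw [ContinuousLinearMap.coe_coe]; exact h244 b i hi ν B hν y) hkill' hcount hsum
    μ (norm_nonneg μ) (fun y => by rw [← Real.norm_eq_abs]; exact norm_le_pi_norm μ y) x

/-- (2.49) as an OPERATOR-NORM bound in the Banach algebra of bounded operators on L^∞(X):
`‖R‖_{L^∞→L^∞} ≤ n₀C₁·θ`. [cite: Balaban1984PropagatorsII, (2.49) p.232] -/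
theorem opNorm_rOp_le (blk : X → g.Site) (D : (X → ℝ) →L[ℝ] (X → ℝ)) (h gl : ι → (X → ℝ) →L[ℝ] (X → ℝ))
    (cubesOf : g.Site → Finset ι) (w : g.Site → g.Site → ℝ) {θ C₁ : ℝ} {n₀ : ℕ} (hθ : 0 ≤ θ)
    (hw : ∀ a b, 0 ≤ w a b)
    (h244 : ∀ b, ∀ i ∈ cubesOf b, ∀ (μ : X → ℝ) (B : ℝ), BlockSupp blk μ b B →
      ∀ x, |bTerm D h gl i μ x| ≤ θ * w (blk x) b * B)
    (hkill : ∀ b, ∀ i ∉ cubesOf b, ∀ (μ : X → ℝ) (B : ℝ), BlockSupp blk μ b B → h i μ = 0)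
    (hcount : ∀ b, (cubesOf b).card ≤ n₀) (hsum : ∀ a, ∑ b, w a b ≤ C₁) (hC₁ : 0 ≤ C₁) :
    ‖rOp D h gl‖ ≤ n₀ * C₁ * θ := by
  refine ContinuousLinearMap.opNorm_le_bound _ (by positivity) fun μ => ?_
  refine (pi_norm_le_iff_of_nonneg (by positivity)).2 fun x => ?_
  rw [Real.norm_eq_abs]
  exact ineq249 blk D h gl cubesOf w hθ hw h244 hkill hcount hsum μ x

/-- *"thus the operator R has a small norm in the space L^∞ for M sufficiently large"*, LOCATED: if the constant of
(2.44) is `θ ≤ c·M⁻¹` then `‖R‖ < 1` as soon as `M > n₀C₁c`. [cite: Balaban1984PropagatorsII, (2.49) p.232] -/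
theorem norm_rOp_lt_one_of_large (blk : X → g.Site) (D : (X → ℝ) →L[ℝ] (X → ℝ))
    (h gl : ι → (X → ℝ) →L[ℝ] (X → ℝ)) (cubesOf : g.Site → Finset ι) (w : g.Site → g.Site → ℝ)
    {θ C₁ c M : ℝ} {n₀ : ℕ} (hθ : 0 ≤ θ) (hw : ∀ a b, 0 ≤ w a b)
    (h244 : ∀ b, ∀ i ∈ cubesOf b, ∀ (μ : X → ℝ) (B : ℝ), BlockSupp blk μ b B →
      ∀ x, |bTerm D h gl i μ x| ≤ θ * w (blk x) b * B)
    (hkill : ∀ b, ∀ i ∉ cubesOf b, ∀ (μ : X → ℝ) (B : ℝ), BlockSupp blk μ b B → h i μ = 0)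
    (hcount : ∀ b, (cubesOf b).card ≤ n₀) (hsum : ∀ a, ∑ b, w a b ≤ C₁) (hC₁ : 0 ≤ C₁)
    (hM : 0 < M) (hθc : θ ≤ c * M⁻¹) (hcM : n₀ * C₁ * c < M) : ‖rOp D h gl‖ < 1 := by
  have h1 : ‖rOp D h gl‖ ≤ n₀ * C₁ * c * M⁻¹ :=
    (opNorm_rOp_le blk D h gl cubesOf w hθ hw h244 hkill hcount hsum hC₁).trans
      (by
        calc (n₀ : ℝ) * C₁ * θ ≤ n₀ * C₁ * (c * M⁻¹) := mul_le_mul_of_nonneg_left hθc (by positivity)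
          _ = n₀ * C₁ * c * M⁻¹ := by ring)
  exact B6Eq250.norm_lt_one_of_large hM h1 hcM

/-- **(2.44) ⇒ (2.49) ⇒ (2.50) in the operator algebra of L^∞(X)**: under (2.36) `Σ_□h_□h_□ = I`, the local-inverse
property `h_□Δ′_aG′(□)h_□ = h_□h_□`, `G′Δ′_a = I`, the (2.44)-majorants of the `K(h_□)G′(□)h_□` with constant `θ ≤ cM⁻¹`,
the locality of the `h_□` (≤ n₀ cubes per block), the lattice sum `Σ_{y′}w ≤ C₁`, and `M > n₀C₁c`: the random-walk
series `G′₀Σ_nRⁿ` CONVERGES TO `G′` in the L^∞ operator norm (`B6Eq250.neumann250` with its `hR` discharged).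
[cite: Balaban1984PropagatorsII, (2.49)–(2.50) p.232] -/
theorem neumann250_of_244 (blk : X → g.Site) (D Gp : (X → ℝ) →L[ℝ] (X → ℝ))
    (h gl : ι → (X → ℝ) →L[ℝ] (X → ℝ)) (hGD : Gp * D = 1) (hpart : ∑ i, h i * h i = 1)
    (hloc : ∀ i, h i * D * gl i * h i = h i * h i) (cubesOf : g.Site → Finset ι) (w : g.Site → g.Site → ℝ)
    {θ C₁ c M : ℝ} {n₀ : ℕ} (hθ : 0 ≤ θ) (hw : ∀ a b, 0 ≤ w a b)
    (h244 : ∀ b, ∀ i ∈ cubesOf b, ∀ (μ : X → ℝ) (B : ℝ), BlockSupp blk μ b B →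
      ∀ x, |bTerm D h gl i μ x| ≤ θ * w (blk x) b * B)
    (hkill : ∀ b, ∀ i ∉ cubesOf b, ∀ (μ : X → ℝ) (B : ℝ), BlockSupp blk μ b B → h i μ = 0)
    (hcount : ∀ b, (cubesOf b).card ≤ n₀) (hsum : ∀ a, ∑ b, w a b ≤ C₁) (hC₁ : 0 ≤ C₁)
    (hM : 0 < M) (hθc : θ ≤ c * M⁻¹) (hcM : n₀ * C₁ * c < M) :
    HasSum (fun N : ℕ => gZero h gl * rOp D h gl ^ N) Gp :=
  B6Eq250.neumann250 D Gp h gl hGD hpart hloc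
    (norm_rOp_lt_one_of_large blk D h gl cubesOf w hθ hw h244 hkill hcount hsum hC₁ hM hθc hcM)

end LInfty

/-! ## §4. The instance on the printed cover: one level, field lattice = the unit lattice of block centres, i.e.
blocks = sites (level j = 0, B⁰(y) = {y}) (the box model
of `B6CoverBox`: sites {0,…,nM}^d, cubes □_k of side 2M centred on the M-lattice, h_k = Π_μ h((x_μ − k_μM)/M)) -/

section BoxModel

open B6CoverBox (boxGeo hprof bdist Kbox sum_hprof_sq card_filter_hprof_ne_zero_le boxGeo_profile Kbox_nonneg)

variable {d n m : ℕ}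

/-- **(2.36) as an operator identity on the model**: operators `h_k` acting as multiplication by the profiles
`h_k(x) = Π_μ h((x_μ − k_μM)/M)` satisfy `Σ_k h_kh_k = I` on L^∞ of the box (from `B6CoverBox.sum_hprof_sq`, the printed
*"Σ_{□∈𝒟} h_□² = 1"*). [cite: Balaban1984PropagatorsII, (2.36) p.229] -/
theorem box_sum_h_mul_h (hm : 0 < m)
    (h : (Fin d → Fin (n + 1)) → ((Fin d → Fin (n * m + 1)) → ℝ) →L[ℝ] ((Fin d → Fin (n * m + 1)) → ℝ))
    (hmul : ∀ k μ x, h k μ x = hprof m k x * μ x) : ∑ k, h k * h k = 1 := by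
  refine ContinuousLinearMap.ext fun μ => funext fun x => ?_
  rw [_root_.sum_apply, Finset.sum_apply, one_apply_eq_self]
  simp_rw [mul_apply_eq_comp, hmul]
  calc ∑ k : Fin d → Fin (n + 1), hprof m k x * (hprof m k x * μ x)
      = (∑ k : Fin d → Fin (n + 1), hprof m k x ^ 2) * μ x := by
        rw [Finset.sum_mul]
        exact Finset.sum_congr rfl fun k _ => by ring
    _ = μ x := by rw [sum_hprof_sq hm x, one_mul]

/-- Locality of the cut-offs on the model: `h_k` annihilates a function supported at a site where the profile `h_k`
vanishes (blocks = sites at this level). [cite: Balaban1984PropagatorsII, (2.36) p.229] -/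
private theorem box_hkill
    (h : (Fin d → Fin (n + 1)) → ((Fin d → Fin (n * m + 1)) → ℝ) →L[ℝ] ((Fin d → Fin (n * m + 1)) → ℝ))
    (hmul : ∀ k μ x, h k μ x = hprof m k x * μ x) (b : Fin d → Fin (n * m + 1)) (k : Fin d → Fin (n + 1))
    (hk : k ∉ Finset.univ.filter fun k : Fin d → Fin (n + 1) => hprof m k b ≠ 0)
    (μ : (Fin d → Fin (n * m + 1)) → ℝ) (B : ℝ)
    (hμ : BlockSupp (g := boxGeo d n m 0 0 0 0 0) (fun x => x) μ b B) : h k μ = 0 := by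
  have hkb : hprof m k b = 0 := by simpa using hk
  funext x
  rw [hmul, Pi.zero_apply]
  by_cases hx : x = b
  · rw [hx, hkb, zero_mul]
  · rw [hμ.off x hx, mul_zero]

/-- From the KERNEL form of (2.44) on the model (`|T_□(x,y)| ≤ θe^{−δ₀|x−y|₁}` for the matrix entries
`T_□(x,y) = (T_□δ_y)(x)`) to the block form consumed by §3 (blocks = sites). [cite: Balaban1984PropagatorsII, (2.44) p.230] -/
private theorem box_h244
    (D : ((Fin d → Fin (n * m + 1)) → ℝ) →L[ℝ] ((Fin d → Fin (n * m + 1)) → ℝ))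
    (h gl : (Fin d → Fin (n + 1)) → ((Fin d → Fin (n * m + 1)) → ℝ) →L[ℝ] ((Fin d → Fin (n * m + 1)) → ℝ))
    {δ₀ θ : ℝ}
    (h244 : ∀ k b x, |bTerm D h gl k (Pi.single b 1) x| ≤ θ * Real.exp (-(δ₀ * bdist x b)))
    (b : Fin d → Fin (n * m + 1)) (k : Fin d → Fin (n + 1)) (μ : (Fin d → Fin (n * m + 1)) → ℝ) (B : ℝ)
    (hμ : BlockSupp (g := boxGeo d n m 0 0 0 0 0) (fun x => x) μ b B) (x : Fin d → Fin (n * m + 1)) :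
    |bTerm D h gl k μ x| ≤ θ * Real.exp (-(δ₀ * bdist x b)) * B := by
  have hμeq : μ = μ b • (Pi.single b 1 : (Fin d → Fin (n * m + 1)) → ℝ) := by
    funext y
    by_cases hy : y = b
    · subst hy
      simp
    · rw [Pi.smul_apply, Pi.single_eq_of_ne hy, smul_zero]
      exact hμ.off y hy
  rw [hμeq, map_smul, Pi.smul_apply, smul_eq_mul, abs_mul]
  calc |μ b| * |bTerm D h gl k (Pi.single b 1) x| ≤ B * (θ * Real.exp (-(δ₀ * bdist x b))) :=
        mul_le_mul (hμ.bound b rfl) (h244 k b x) (abs_nonneg _) hμ.nonneg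
    _ = θ * Real.exp (-(δ₀ * bdist x b)) * B := by ring

/-- **(2.49) on the printed cover** (one level, blocks = sites — the level j = 0 of the cover): if the operators `h_k` act
as multiplication by the cut-offs `h_k` of (2.36) and every summand `T_k = K(h_k)G′(□_k)h_k` of `R` has the (2.44)
kernel bound `|T_k(x,y)| ≤ θe^{−δ₀|x−y|₁}` (θ = the printed O(M⁻¹)), then `|(Rλ)(x)| ≤ 2^d·K_d(δ₀)·θ·‖λ‖_∞` for EVERY λ,
with `K_d(δ₀) = (2(1 − e^{−δ₀})⁻¹)^d` — the overlap number 2^d (`card_filter_hprof_ne_zero_le`) and the lattice sum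
(`boxGeo_profile`) DISCHARGED, uniformly in the volume n. [cite: Balaban1984PropagatorsII, (2.49) p.232] -/
theorem box_ineq249 (hm : 0 < m) {δ₀ θ : ℝ} (hδ₀ : 0 < δ₀) (hθ : 0 ≤ θ)
    (D : ((Fin d → Fin (n * m + 1)) → ℝ) →L[ℝ] ((Fin d → Fin (n * m + 1)) → ℝ))
    (h gl : (Fin d → Fin (n + 1)) → ((Fin d → Fin (n * m + 1)) → ℝ) →L[ℝ] ((Fin d → Fin (n * m + 1)) → ℝ))
    (hmul : ∀ k μ x, h k μ x = hprof m k x * μ x)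
    (h244 : ∀ k b x, |bTerm D h gl k (Pi.single b 1) x| ≤ θ * Real.exp (-(δ₀ * bdist x b)))
    (μ : (Fin d → Fin (n * m + 1)) → ℝ) (x : Fin d → Fin (n * m + 1)) :
    |rOp D h gl μ x| ≤ (2 : ℝ) ^ d * Kbox d δ₀ * θ * ‖μ‖ := by
  have key := ineq249 (g := boxGeo d n m 0 0 0 0 0) (fun y => y) D h gl
    (fun b => Finset.univ.filter fun k : Fin d → Fin (n + 1) => hprof m k b ≠ 0)
    (fun a b => Real.exp (-(δ₀ * bdist a b))) (n₀ := 2 ^ d) hθ (fun _ _ => (Real.exp_pos _).le)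
    (fun b k _ ν B hν y => box_h244 D h gl h244 b k ν B hν y)
    (fun b k hk ν B hν => box_hkill h hmul b k hk ν B hν)
    (fun b => card_filter_hprof_ne_zero_le hm b) (fun a => boxGeo_profile d n m 0 0 0 0 0 δ₀ hδ₀ a) μ x
  simpa only [Nat.cast_pow, Nat.cast_ofNat] using key

/-- **(2.44) ⇒ (2.49) ⇒ (2.50) on the printed cover**: with `h_k` = multiplication by the cut-offs of (2.36) (so
`Σ_kh_kh_k = I` HOLDS, `box_sum_h_mul_h`), local inverses `G′(□_k)` (`h_kΔ′_aG′(□_k)h_k = h_kh_k`), `G′Δ′_a = I`, the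
(2.44) kernel bounds with `θ ≤ c/M`, and `M > 2^dK_d(δ₀)c` (*"M sufficiently large"*, explicit): the series (2.50)
`G′₀Σ_NR^N` converges to `G′` in the operator norm of L^∞ of the box. [cite: Balaban1984PropagatorsII, (2.49)–(2.50) p.232] -/
theorem box_neumann250_of_244 (hm : 0 < m) {δ₀ θ c : ℝ} (hδ₀ : 0 < δ₀) (hθ : 0 ≤ θ)
    (D Gp : ((Fin d → Fin (n * m + 1)) → ℝ) →L[ℝ] ((Fin d → Fin (n * m + 1)) → ℝ))
    (h gl : (Fin d → Fin (n + 1)) → ((Fin d → Fin (n * m + 1)) → ℝ) →L[ℝ] ((Fin d → Fin (n * m + 1)) → ℝ))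
    (hmul : ∀ k μ x, h k μ x = hprof m k x * μ x) (hGD : Gp * D = 1)
    (hloc : ∀ k, h k * D * gl k * h k = h k * h k)
    (h244 : ∀ k b x, |bTerm D h gl k (Pi.single b 1) x| ≤ θ * Real.exp (-(δ₀ * bdist x b)))
    (hθc : θ ≤ c * (m : ℝ)⁻¹) (hcM : (2 : ℝ) ^ d * Kbox d δ₀ * c < m) :
    HasSum (fun N : ℕ => gZero h gl * rOp D h gl ^ N) Gp := by
  have hm' : (0 : ℝ) < m := by exact_mod_cast hm
  have hcM' : ((2 ^ d : ℕ) : ℝ) * Kbox d δ₀ * c < m := by simpa only [Nat.cast_pow, Nat.cast_ofNat] using hcM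
  exact neumann250_of_244 (g := boxGeo d n m 0 0 0 0 0) (fun y => y) D Gp h gl hGD (box_sum_h_mul_h hm h hmul) hloc
    (fun b => Finset.univ.filter fun k : Fin d → Fin (n + 1) => hprof m k b ≠ 0)
    (fun a b => Real.exp (-(δ₀ * bdist a b))) (n₀ := 2 ^ d) hθ (fun _ _ => (Real.exp_pos _).le)
    (fun b k _ ν B hν y => box_h244 D h gl h244 b k ν B hν y)
    (fun b k hk ν B hν => box_hkill h hmul b k hk ν B hν)
    (fun b => card_filter_hprof_ne_zero_le hm b) (fun a => boxGeo_profile d n m 0 0 0 0 0 δ₀ hδ₀ a)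
    (Kbox_nonneg d hδ₀) hm' hθc hcM'

end BoxModel

/-! ## §5 (v1.1). (2.44) ⇒ (2.51): the block majorant of `R` that the (2.64)–(2.66) chain of `B6RandomWalk` consumes -/

section Majorant251

variable {g : B6.Geometry} {X : Type} {ι : Type*} [Fintype ι]

/-- **(2.44) ⇒ (2.51)** (p. 232, verbatim: *"To investigate properties of G′, and especially an exponential decay, we
will use another bound for the operator R. From (2.44) and (2.38) we have |(Rλ)(x)| ≤ O(M⁻¹)e^{−δ₀d(x,y)}|λ| if
supp λ ⊂ B^j(y), y ∈ Λ_j. (2.51)"*): if the (2.44) bounds of the summands `T_□` are read with the factor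
`e^{−δ₀d(y(x),y)}` in the multiscale distance d of (2.46) (the comparison with the printed euclidean |x − y| on the
L^{−j}-scale inside one cube is the located input G-pv08-2 of `B6RandomWalk`, not claimed here), then `R = Σ_□T_□` has
the (2.51) majorant `(n₀θ)·e^{−δ₀d(y,y′)}` — exactly the hypothesis `hR` of `B6RandomWalk.majorant_pow_265` /
`majorant_of_fixedPoint_266` ((2.64)–(2.66)), with O(M⁻¹) = n₀θ. [cite: Balaban1984PropagatorsII, (2.51) p.232] -/
theorem hasMajorant251_of_244 (blk : X → g.Site) (T : ι → Module.End ℝ (X → ℝ)) (cubesOf : g.Site → Finset ι)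
    {θ δ₀ : ℝ} {n₀ : ℕ} (hθ : 0 ≤ θ)
    (h244 : ∀ b, ∀ i ∈ cubesOf b, ∀ (μ : X → ℝ) (B : ℝ), BlockSupp blk μ b B →
      ∀ x, |T i μ x| ≤ θ * Real.exp (-(δ₀ * g.dist (blk x) b)) * B)
    (hkill : ∀ b, ∀ i ∉ cubesOf b, ∀ (μ : X → ℝ) (B : ℝ), BlockSupp blk μ b B → T i μ = 0)
    (hcount : ∀ b, (cubesOf b).card ≤ n₀) :
    HasMajorant blk (∑ i, T i) (fun a b => (n₀ * θ) * Real.exp (-(δ₀ * g.dist a b))) :=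
  hasMajorant_sum_of_244 blk T cubesOf (fun a b => Real.exp (-(δ₀ * g.dist a b))) hθ
    (fun _ _ => (Real.exp_pos _).le) h244 hkill hcount

/-- **(2.44) ⇒ (2.51) for `R = B6Eq250.rOp D h g`** (the operator of (2.38) on L^∞(X)), as a `B6RandomWalk.HasMajorant`
statement about the underlying linear map: majorant `(n₀θ)·e^{−δ₀d(y,y′)}`. [cite: Balaban1984PropagatorsII, (2.51) p.232] -/
theorem hasMajorant251_rOp_of_244 (blk : X → g.Site) (D : (X → ℝ) →L[ℝ] (X → ℝ))
    (h gl : ι → (X → ℝ) →L[ℝ] (X → ℝ)) (cubesOf : g.Site → Finset ι) {θ δ₀ : ℝ} {n₀ : ℕ} (hθ : 0 ≤ θ)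
    (h244 : ∀ b, ∀ i ∈ cubesOf b, ∀ (μ : X → ℝ) (B : ℝ), BlockSupp blk μ b B →
      ∀ x, |bTerm D h gl i μ x| ≤ θ * Real.exp (-(δ₀ * g.dist (blk x) b)) * B)
    (hkill : ∀ b, ∀ i ∉ cubesOf b, ∀ (μ : X → ℝ) (B : ℝ), BlockSupp blk μ b B → h i μ = 0)
    (hcount : ∀ b, (cubesOf b).card ≤ n₀) :
    HasMajorant blk (↑(rOp D h gl) : Module.End ℝ (X → ℝ))
      (fun a b => (n₀ * θ) * Real.exp (-(δ₀ * g.dist a b))) := by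
  have hkill' : ∀ b, ∀ i ∉ cubesOf b, ∀ (μ : X → ℝ) (B : ℝ), BlockSupp blk μ b B →
      (↑(bTerm D h gl i) : Module.End ℝ (X → ℝ)) μ = 0 := by
    intro b i hi ν B hν
    rw [ContinuousLinearMap.coe_coe, B6Eq250.bTerm_apply, mul_apply_eq_comp, mul_apply_eq_comp,
      hkill b i hi ν B hν, map_zero, map_zero]
  have key := hasMajorant251_of_244 blk (fun i => (↑(bTerm D h gl i) : Module.End ℝ (X → ℝ))) cubesOf hθ
    (fun b i hi ν B hν y => by rw [ContinuousLinearMap.coe_coe]; exact h244 b i hi ν B hν y) hkill' hcount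
  intro b ν B hν x
  have hR : (↑(rOp D h gl) : Module.End ℝ (X → ℝ)) ν x =
      (∑ i, (↑(bTerm D h gl i) : Module.End ℝ (X → ℝ))) ν x := by
    simp only [ContinuousLinearMap.coe_coe, B6Eq250.rOp_eq_sum_bTerm, _root_.sum_apply, LinearMap.sum_apply,
      Finset.sum_apply]
  rw [hR]
  exact key b ν B hν x

end Majorant251

end Literature.MathematicalPhysics.QuantumFieldTheory.Balaban1983to89.B6Ineq249Proof
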